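import Summits.QuantumFields.YangMills.Theorems.BalabanUVNodesN21ThresholdMixtureRStepFactors
import Summits.QuantumFields.YangMills.Theorems.BalabanUVNodesN21ThresholdMixtureTStepChi

/-!
# N21 (NE7c), strategy s3 «alternative currency», file 21 — file 20 AT THE COMMON-BOX LETTERS: the post-ℝ family of a mixed-polarity sharp product
# averages to the (η)-PROFILED product in front of the threshold-free normalised slot (13a∕14a's `hXs`∕`hA` pair survives the typed ℝ)

Seat `pub-ymgap-dag-n21-e` (R141 (C) fan-out, node N21 = NE7c `T4IndicatorShell.ShellWeightBound`, strategy s3), g8.  Lane: `--kind proof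
--supports stmt-QuantumFields-20292 --as helper` (K3⁗ `SpineGivenEndpointR13Sep`).  Count-neutral.  Companion of file 20
(`…N21ThresholdMixtureRStepFactors`): there, for pieces `t_a(S) = c_a(S)·f_a` with fibre-independent, selector-monotone sharp factors, the typed
(0.3) quotient ([Balaban1989LargeFieldI] p. 176; b01 `B15.BasicStep.RopReal`, def-R FILE 7 `Node00.rstepOfSel`) is `Σ_a c_a(S)·normTerm(fib a)(f_{sel a})(f_a)`
with (0.4) per summand.  HERE the sharp factor is the mixture road's own letter — 13a∕14a's mixed-polarity per-occurrence product
`c^S_a = ∏_{c ∈ A a} (pol a c).fac 1[u_c < S_c]` (p491254∕p495878; one multiplier `S_c ∈ [(1−κ_c)θ_c, θ_c]` per occurrence `c : ι` of the step, term `a`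
reading the sub-family `A a`) — and the two kill-test hypotheses take their COMBINATORIAL form:

* (KT-28 «no») every tested variable the term or its receiver reads is fibre-independent: `FibreIndep (fib a) (u c)` for `c ∈ A a ∪ A (sel a)` — then so
  are the products (`fibreIndep_prod_fac_smallInd`, §1);
* (KT-26 «no», combinatorial) the receiver reads a SUB-family of the sender's occurrences with the SAME polarities: `A (sel a) ⊆ A a`,
  `pol (sel a) c = pol a c` on `A (sel a)` — then `c^S_a ≤ c^S_{sel a}` at every `S` because every factor lies in `[0, 1]` (`prod_fac_smallInd_le_of_subset`, §1).

Consequences (§2–§3): at every field `V`, the NORMALISED COMMON-BOX AVERAGE of the post-ℝ density is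
`Σ_a (∏_{c ∈ A a} (pol a c).fac (linProfile κ_c (u_c(V)∕θ_c))) · normTerm(fib a)(f_{sel a})(f_a)(V)` (★ `commonBox_average_ropReal_eq_profile` — file 20's
`integral_ropReal_family_eq_of_le` × 14a's `commonBox_average_prod_fac_smallInd_eq`): design (η)'s PROFILED product in front of the SAME threshold-free slot;
and for each old index the field-integrated pair «sharp weight at `S`» ∕ «profiled weight» is 14a's `commonBox_average_facWeight_eq` with the remainder
`R := normTerm(fib a)(f_{sel a})(f_a)` — integrable under the threshold-free `TermProvisos` (★ `commonBox_average_rstepWeight_eq_profile`).  With (0.4) per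
summand at every `S` (file 20 `integral_factor_normTerm_eq_of_le`, restated at these letters as `integral_rstepSummand_eq`) this is EXACTLY the
`hXs`∕`hA` input list of the K5 common-box readings (p479591 ∕ p483387) for the post-ℝ family: off the fibre, ℝ changes the mixture road's displayed list
by NOTHING.  (Occurrences ON fibre bonds: file 16's `D`.)

SCOPE (honest, located).  File 20's pointwise shape «sharp factor × THRESHOLD-FREE remainder» (§2–§3 here) is met by the occurrences that are POINTWISE
factors of the current-level density at the time of the ℝ-step — the step's own (2.17) front factor `χ_{k+1}` and (3.2) labels (functions of `V_{k+1}`).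
Randomised occurrences of OLDER levels sit inside the slot's 𝐓-integrals (15 §1), so the slot `f^S_a` itself depends on `S` and the post-ℝ DENSITY is
nonlinear in the coordinates the sender and receiver share (16's sandwich species).  What survives for them is §4: (0.4) PER OLD SUMMAND holds AT EVERY
`S` whatever the `S`-dependence of the slots (`rstepWeight_eq`), so every post-ℝ term WEIGHT equals the pre-ℝ weight at every `S` and integrates over
any multiplier law to the same average (`integral_rstepWeight_eq`) — and the mixture road reads terms ONLY through weights (the K5 readings' `Xs`, E1∕E2,
class binders, shell weights).  Hence: given KT-26∕KT-28 for the pointwise factors at each ℝ-step, a joint-space `hXs` representation of the PRE-ℝ weights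
(the pure 𝐓-tower, multilinear in all sharp factors — NODE O's (O-mix-1)) IS one for the post-ℝ weights.  Occurrences ON fibre bonds: file 16's `D`.

HONEST FRAMING.  NE7c is NOT PRINTED and NOT PROVED.  [folklore] bookkeeping (products of `[0,1]`-valued factors, one Fubini on a finite box) over file 20
and 13a∕14a; the kill-test answers (KT-26∕KT-28 in the combinatorial form above) are def-R's ∕ NODE O's to give about `PpSelOfRecord` ∕ `fibOfSeq` ∕ the
(2.2)–(2.3) geometry and are HYPOTHESES here; the mixture (a convex combination of print's SHARP procedure over admissible threshold vectors) is design,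
NOT print verbatim; (M1) for print's sharp procedure untouched; nothing of Bałaban's asserted; N21 NOT discharged; count-neutral; one finite 𝕋⁴ at
fixed `ε`; NOT ℝ⁴ ∕ OS ∕ gap ∕ Clay.

CITATION HEADER (lean-in-tree rule 2026-08-18).  BY NAME: file 20 `ropReal_factor_eq_sum_of_le` ∕ `integral_ropReal_family_eq_of_le` ∕
`integral_factor_normTerm_eq_of_le`; 14a `prod_fac_smallInd_mem_unitInterval` ∕ `commonBox_average_prod_fac_smallInd_eq` ∕ `commonBox_average_facWeight_eq`;
b01 `B15.BasicStep.normTerm` ∕ `RopReal`; `T4DressedR.FibreIndep`; `T4ObservableTelescope.TermProvisos`; `T4IndicatorShell.smallInd`; `T4LipschitzCutoff.linProfile`;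
`T4LipschitzLedger.Pol`.  Context only (SHAPE): [Balaban1989LargeFieldI] (0.3)–(0.4) p. 176.

WHAT IS PROVED ([folklore]).  §1 `fibreIndep_prod_fac_smallInd` · `prod_fac_smallInd_le_of_subset` · `measurable_prod_fac_smallInd_field` ·
`measurable_prod_fac_smallInd_thr` · `integrable_prod_fac_smallInd_box`; §2 ★ `commonBox_integral_ropReal_eq` · ★★ `commonBox_average_ropReal_eq_profile`;
§3 `integrable_normTerm_of_provisos` · `integral_rstepSummand_eq` · ★ `commonBox_average_rstepWeight_eq_profile`; §4 ★★ `rstepWeight_eq` · ★ `integral_rstepWeight_eq`.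
-/

set_option autoImplicit false

noncomputable section

open MeasureTheory Set
open scoped BigOperators ENNReal

namespace Summit.QuantumFields.YangMills.Theorems.N21ThresholdMixtureRStepCommonBox

open Literature.MathematicalPhysics.QuantumFieldTheory.Balaban1983to89
open Literature.MathematicalPhysics.QuantumFieldTheory.Balaban1983to89.B15.BasicStep (fibreIntegral normTerm RopReal)
open Literature.MathematicalPhysics.QuantumFieldTheory.Balaban1983to89.T4DressedR (FibreIndep)
open Literature.MathematicalPhysics.QuantumFieldTheory.Balaban1983to89.T4ObservableTelescope (TermProvisos)
open Literature.MathematicalPhysics.QuantumFieldTheory.Balaban1983to89.T4IndicatorShell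
open Literature.MathematicalPhysics.QuantumFieldTheory.Balaban1983to89.T4LipschitzCutoff
open Literature.MathematicalPhysics.QuantumFieldTheory.Balaban1983to89.T4LipschitzLedger
open Summit.QuantumFields.YangMills.Theorems.N21ThresholdMixtureTStepChi (prod_fac_smallInd_mem_unitInterval
  commonBox_average_prod_fac_smallInd_eq commonBox_average_facWeight_eq)
open Summit.QuantumFields.YangMills.Theorems.N21ThresholdMixtureRStepFactors

variable {P : Params} {j : ℕ} {G : Type*} [GaugeGroup G] [MeasurableSpace G] [HaarData G]
variable [DecidableEq (PBond P j)]
variable {ι : Type*}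

/-! ## §1 The mixed-polarity sharp product as a fibre-independent, selector-monotone, box-integrable factor -/

section Letters

omit [GaugeGroup G] [MeasurableSpace G] [HaarData G] in
/-- (KT-28 «no» ⇒) a sharp product of fibre-independent tested variables is fibre-independent. [folklore] -/
theorem fibreIndep_prod_fac_smallInd (s : Finset (PBond P j)) (A : Finset ι) (pol : ι → Pol) {u : ι → Density P j G}
    (hu : ∀ c ∈ A, FibreIndep s (u c)) (S : ι → ℝ) :
    FibreIndep s (fun V => ∏ c ∈ A, (pol c).fac (smallInd (u c V) (S c))) := fun x y => by
  dsimp only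
  exact Finset.prod_congr rfl fun c hc => by rw [hu c hc x y]

/-- (KT-26 «no», combinatorial ⇒) a receiver reading a SUB-family of the sender's occurrences with the same polarities has the LARGER sharp
product: `∏_{A} ≤ ∏_{A″}` for `A″ ⊆ A` (every factor lies in `[0, 1]`). [folklore] -/
theorem prod_fac_smallInd_le_of_subset {A A'' : Finset ι} (hsub : A'' ⊆ A) (pol pol'' : ι → Pol)
    (hpol : ∀ c ∈ A'', pol'' c = pol c) (u S : ι → ℝ) :
    ∏ c ∈ A, (pol c).fac (smallInd (u c) (S c)) ≤ ∏ c ∈ A'', (pol'' c).fac (smallInd (u c) (S c)) := by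
  classical
  have hsplit := Finset.prod_sdiff hsub (f := fun c => (pol c).fac (smallInd (u c) (S c)))
  rw [← hsplit]
  have h1 : ∏ c ∈ A \ A'', (pol c).fac (smallInd (u c) (S c)) ≤ 1 :=
    Finset.prod_le_one (fun c _ => Pol.fac_nonneg (smallInd_nonneg _ _) (smallInd_le_one _ _) (pol c))
      fun c _ => Pol.fac_le_one (smallInd_nonneg _ _) (smallInd_le_one _ _) (pol c)
  have h0 : 0 ≤ ∏ c ∈ A'', (pol c).fac (smallInd (u c) (S c)) :=
    Finset.prod_nonneg fun c _ => Pol.fac_nonneg (smallInd_nonneg _ _) (smallInd_le_one _ _) (pol c)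
  have heq : ∏ c ∈ A'', (pol'' c).fac (smallInd (u c) (S c)) = ∏ c ∈ A'', (pol c).fac (smallInd (u c) (S c)) :=
    Finset.prod_congr rfl fun c hc => by rw [hpol c hc]
  rw [heq]
  exact (mul_le_mul_of_nonneg_right h1 h0).trans_eq (one_mul _)

omit [GaugeGroup G] [HaarData G] [DecidableEq (PBond P j)] in
/-- The sharp product is measurable in the field at a fixed threshold vector. [folklore] -/
theorem measurable_prod_fac_smallInd_field (A : Finset ι) (pol : ι → Pol) {u : ι → Density P j G} (hu : ∀ c ∈ A, Measurable (u c))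
    (S : ι → ℝ) : Measurable fun V => ∏ c ∈ A, (pol c).fac (smallInd (u c V) (S c)) := by
  refine Finset.measurable_prod _ fun c hc => (Pol.measurable_fac (pol c)).comp ?_
  unfold smallInd
  exact Measurable.ite (measurableSet_lt (hu c hc) measurable_const) measurable_const measurable_const

/-- The sharp product is measurable in the threshold vector at fixed tested values. [folklore] -/
theorem measurable_prod_fac_smallInd_thr (A : Finset ι) (pol : ι → Pol) (u : ι → ℝ) :
    Measurable fun S : ι → ℝ => ∏ c ∈ A, (pol c).fac (smallInd (u c) (S c)) := by
  refine Finset.measurable_prod _ fun c _ => (Pol.measurable_fac (pol c)).comp ?_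
  unfold smallInd
  exact Measurable.ite (measurableSet_lt measurable_const (measurable_pi_apply c)) measurable_const measurable_const

/-- On a finite box the sharp product is integrable in the threshold vector (bounded by `1`, finite measure). [folklore] -/
theorem integrable_prod_fac_smallInd_box [Fintype ι] (A : Finset ι) (pol : ι → Pol) (u : ι → ℝ) (lo hi : ι → ℝ) :
    Integrable (fun S : ι → ℝ => ∏ c ∈ A, (pol c).fac (smallInd (u c) (S c)))
      (Measure.pi fun c : ι => volume.restrict (Icc (lo c) (hi c))) := by
  refine Integrable.mono' (integrable_const (1 : ℝ)) (measurable_prod_fac_smallInd_thr A pol u).aestronglyMeasurable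
    (ae_of_all _ fun S => ?_)
  have h01 := prod_fac_smallInd_mem_unitInterval A pol u S
  rw [Real.norm_of_nonneg h01.1]
  exact h01.2

end Letters

/-! ## §2 The common-box average of the post-ℝ density of a sharp-product family -/

section Box

variable [Fintype ι] [DecidableEq ι] {R : Type*} [Fintype R]

omit [DecidableEq ι] in
/-- ★ **THE COMMON-BOX INTEGRAL OF THE POST-ℝ DENSITY** (file 20 §3 at the letters): for pieces
`t_a(S) = (∏_{c ∈ A a} (pol a c).fac 1[u_c < S_c]) · f_a` whose read tested variables are fibre-independent (KT-28 «no») and whose receivers read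
sub-families with the same polarities (KT-26 «no»), at every field `V`
`∫_box ℝ(t_S)(V) dS = Σ_a (∫_box ∏_{c ∈ A a} (pol a c).fac 1[u_c(V) < S_c] dS) · normTerm(fib a)(f_{sel a})(f_a)(V)`. [folklore] -/
theorem commonBox_integral_ropReal_eq (A : R → Finset ι) (pol : R → ι → Pol) (u : ι → Density P j G) (f : R → Density P j G)
    (sel : R → R) (fib : R → Finset (PBond P j)) (hf : ∀ a, Measurable (f a)) (hu : ∀ a, ∀ c ∈ A a, FibreIndep (fib a) (u c))
    (hsub : ∀ a, A (sel a) ⊆ A a) (hpol : ∀ a, ∀ c ∈ A (sel a), pol (sel a) c = pol a c) (lo hi : ι → ℝ) (V : GaugeField P j G) :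
    ∫ S, RopReal (fun a U => (∏ c ∈ A a, (pol a c).fac (smallInd (u c U) (S c))) * f a U) sel fib V
        ∂(Measure.pi fun c : ι => volume.restrict (Icc (lo c) (hi c)))
      = ∑ a, (∫ S, ∏ c ∈ A a, (pol a c).fac (smallInd (u c V) (S c)) ∂(Measure.pi fun c : ι => volume.restrict (Icc (lo c) (hi c))))
          * normTerm (fib a) (f (sel a)) (f a) V :=
  integral_ropReal_family_eq_of_le (Measure.pi fun c : ι => volume.restrict (Icc (lo c) (hi c)))
    (fun S a U => ∏ c ∈ A a, (pol a c).fac (smallInd (u c U) (S c))) f sel fib hf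
    (fun S a => fibreIndep_prod_fac_smallInd (fib a) (A a) (pol a) (hu a) S)
    (fun S a => fibreIndep_prod_fac_smallInd (fib a) (A (sel a)) (pol (sel a)) (fun c hc => hu a c (hsub a hc)) S)
    (fun S a U => (prod_fac_smallInd_mem_unitInterval (A a) (pol a) (fun c => u c U) S).1)
    (fun S a U => prod_fac_smallInd_le_of_subset (hsub a) (pol a) (pol (sel a)) (hpol a) (fun c => u c U) S) V
    fun a => integrable_prod_fac_smallInd_box (A a) (pol a) (fun c => u c V) lo hi

/-- ★★ **THE NORMALISED COMMON-BOX AVERAGE OF THE POST-ℝ DENSITY IS (η)'s PROFILED PRODUCT IN FRONT OF THE SAME THRESHOLD-FREE SLOT**: with windows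
`[(1−κ_c)θ_c, θ_c]`, `(∏_c κ_cθ_c)⁻¹·∫_box ℝ(t_S)(V) dS = Σ_a (∏_{c ∈ A a} (pol a c).fac (linProfile κ_c (u_c(V)∕θ_c))) · normTerm(fib a)(f_{sel a})(f_a)(V)`
— off the fibre, ℝ leaves the mixture road's (η)-face dictionary (5b p467851 ∕ 13a ∕ 14a) untouched. [folklore] -/
theorem commonBox_average_ropReal_eq_profile (A : R → Finset ι) (pol : R → ι → Pol) (u : ι → Density P j G) (f : R → Density P j G)
    (sel : R → R) (fib : R → Finset (PBond P j)) (hf : ∀ a, Measurable (f a)) (hu : ∀ a, ∀ c ∈ A a, FibreIndep (fib a) (u c))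
    (hsub : ∀ a, A (sel a) ⊆ A a) (hpol : ∀ a, ∀ c ∈ A (sel a), pol (sel a) c = pol a c) (κ θ : ι → ℝ) (hκ : ∀ c, 0 < κ c)
    (hθ : ∀ c, 0 < θ c) (V : GaugeField P j G) :
    (∏ c, (κ c * θ c))⁻¹ *
        ∫ S, RopReal (fun a U => (∏ c ∈ A a, (pol a c).fac (smallInd (u c U) (S c))) * f a U) sel fib V
          ∂(Measure.pi fun c : ι => volume.restrict (Icc ((1 - κ c) * θ c) (θ c)))
      = ∑ a, (∏ c ∈ A a, (pol a c).fac (linProfile (κ c) (u c V / θ c))) * normTerm (fib a) (f (sel a)) (f a) V := by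
  rw [commonBox_integral_ropReal_eq A pol u f sel fib hf hu hsub hpol (fun c => (1 - κ c) * θ c) θ V, Finset.mul_sum]
  refine Finset.sum_congr rfl fun a _ => ?_
  rw [← mul_assoc, commonBox_average_prod_fac_smallInd_eq (A a) (pol a) κ θ (fun c => u c V) hκ hθ]

end Box

/-! ## §3 The field-integrated pair for each old index: sharp weight at `S` ∕ profiled weight, and (0.4) per summand -/

section Weights

/-- Under the threshold-free provisos the normalised slot is integrable (the remainder `R` of 14a's pair). [folklore] -/
theorem integrable_normTerm_of_provisos (s : Finset (PBond P j)) {f f'' : Density P j G} {C : ℝ} (hP : TermProvisos s f'' f C) :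
    Integrable (normTerm s f'' f) (fieldMeasure P j G) :=
  hP.integrable_normTerm

/-- **(0.4) PER SUMMAND AT THESE LETTERS, at every threshold vector**: the post-ℝ summand `normTerm(s)(c″_S·f″)(c_S·f)` of a sender whose receiver
reads a sub-family with the same polarities has the sender's sharp mass `∫ c_S·f dV` (file 20 `integral_factor_normTerm_eq_of_le`). [cite: Balaban1989LargeFieldI, (0.4) p.176] -/
theorem integral_rstepSummand_eq (s : Finset (PBond P j)) {A A'' : Finset ι} (hsub : A'' ⊆ A) (pol pol'' : ι → Pol)
    (hpol : ∀ c ∈ A'', pol'' c = pol c) {u : ι → Density P j G} (huI : ∀ c ∈ A, FibreIndep s (u c)) (hum : ∀ c ∈ A, Measurable (u c))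
    {f f'' : Density P j G} {C : ℝ} (hP : TermProvisos s f'' f C) (S : ι → ℝ) :
    ∫ V, normTerm s (fun U => (∏ c ∈ A'', (pol'' c).fac (smallInd (u c U) (S c))) * f'' U)
        (fun U => (∏ c ∈ A, (pol c).fac (smallInd (u c U) (S c))) * f U) V ∂fieldMeasure P j G
      = ∫ V, (∏ c ∈ A, (pol c).fac (smallInd (u c V) (S c))) * f V ∂fieldMeasure P j G :=
  integral_factor_normTerm_eq_of_le s hP (measurable_prod_fac_smallInd_field A pol hum S)
    (measurable_prod_fac_smallInd_field A'' pol'' (fun c hc => hum c (hsub hc)) S)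
    (fibreIndep_prod_fac_smallInd s A pol huI S) (fibreIndep_prod_fac_smallInd s A'' pol'' (fun c hc => huI c (hsub hc)) S)
    (fun V => (prod_fac_smallInd_mem_unitInterval A pol (fun c => u c V) S).1)
    (fun V => (prod_fac_smallInd_mem_unitInterval A'' pol'' (fun c => u c V) S).1)
    (fun V => (prod_fac_smallInd_mem_unitInterval A pol (fun c => u c V) S).2)
    fun V => prod_fac_smallInd_le_of_subset hsub pol pol'' hpol (fun c => u c V) S

variable [Fintype ι] [DecidableEq ι]

/-- ★ **THE `hXs`∕`hA` PAIR OF A POST-ℝ SUMMAND** (14a `commonBox_average_facWeight_eq` with `R :=` the threshold-free normalised slot): the normalised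
common-box average of the SHARP weight `∫ (∏_{c ∈ A} (pol c).fac 1[u_c < S_c])·normTerm(s)(f″)(f) dV` is the PROFILED weight
`∫ (∏_{c ∈ A} (pol c).fac (linProfile κ_c (u_c∕θ_c)))·normTerm(s)(f″)(f) dV`. [folklore] -/
theorem commonBox_average_rstepWeight_eq_profile (s : Finset (PBond P j)) (A : Finset ι) (pol : ι → Pol) (κ θ : ι → ℝ)
    {u : ι → Density P j G} (hu : ∀ c ∈ A, Measurable (u c)) {f f'' : Density P j G} {C : ℝ} (hP : TermProvisos s f'' f C)
    (hκ : ∀ c, 0 < κ c) (hθ : ∀ c, 0 < θ c) :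
    (∏ c, (κ c * θ c))⁻¹ *
        ∫ S, (∫ V, (∏ c ∈ A, (pol c).fac (smallInd (u c V) (S c))) * normTerm s f'' f V ∂fieldMeasure P j G)
          ∂(Measure.pi fun c : ι => volume.restrict (Icc ((1 - κ c) * θ c) (θ c)))
      = ∫ V, (∏ c ∈ A, (pol c).fac (linProfile (κ c) (u c V / θ c))) * normTerm s f'' f V ∂fieldMeasure P j G :=
  commonBox_average_facWeight_eq (fieldMeasure P j G) A pol κ θ hu hP.integrable_normTerm hκ hθ

end Weights

/-! ## §4 WEIGHTS: (0.4) per old summand at every threshold vector, whatever the `S`-dependence of the slots -/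

section WeightsS

variable {Θ : Type*} [MeasurableSpace Θ]

omit [MeasurableSpace Θ] in
/-- ★★ **POST-ℝ WEIGHT = PRE-ℝ WEIGHT AT EVERY THRESHOLD VECTOR, for slots that may themselves depend on `S`** (older randomised occurrences inside the
slot's 𝐓-integrals): with the sender's and receiver's POINTWISE sharp products over `A ⊇ A″` (same polarities, fibre-independent tested variables) and
threshold-free provisos on the slots AT EACH `S`, `∫ normTerm(s)(c″_S·f″_S)(c_S·f_S) dV = ∫ c_S·f_S dV` for every `S`.  The post-ℝ DENSITY is nonlinear in
the shared older coordinates; its WEIGHT is not. [cite: Balaban1989LargeFieldI, (0.4) p.176] -/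
theorem rstepWeight_eq (s : Finset (PBond P j)) {A A'' : Finset ι} (hsub : A'' ⊆ A) (pol pol'' : ι → Pol) (hpol : ∀ c ∈ A'', pol'' c = pol c)
    {u : ι → Density P j G} (huI : ∀ c ∈ A, FibreIndep s (u c)) (hum : ∀ c ∈ A, Measurable (u c)) (fS f''S : Θ → Density P j G) {C : ℝ}
    (hP : ∀ S, TermProvisos s (f''S S) (fS S) C) (thr : Θ → ι → ℝ) (S : Θ) :
    ∫ V, normTerm s (fun U => (∏ c ∈ A'', (pol'' c).fac (smallInd (u c U) (thr S c))) * f''S S U)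
        (fun U => (∏ c ∈ A, (pol c).fac (smallInd (u c U) (thr S c))) * fS S U) V ∂fieldMeasure P j G
      = ∫ V, (∏ c ∈ A, (pol c).fac (smallInd (u c V) (thr S c))) * fS S V ∂fieldMeasure P j G :=
  integral_rstepSummand_eq s hsub pol pol'' hpol huI hum (hP S) (thr S)

/-- ★ Hence over ANY multiplier law the post-ℝ and pre-ℝ weights have the same integral — everything the mixture road reads through term WEIGHTS (the K5
readings' `Xs`, E1∕E2, class binders, shell weights) passes through ℝ at the level of the older occurrences too. [folklore] -/
theorem integral_rstepWeight_eq (μ : Measure Θ) (s : Finset (PBond P j)) {A A'' : Finset ι} (hsub : A'' ⊆ A) (pol pol'' : ι → Pol)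
    (hpol : ∀ c ∈ A'', pol'' c = pol c) {u : ι → Density P j G} (huI : ∀ c ∈ A, FibreIndep s (u c)) (hum : ∀ c ∈ A, Measurable (u c))
    (fS f''S : Θ → Density P j G) {C : ℝ} (hP : ∀ S, TermProvisos s (f''S S) (fS S) C) (thr : Θ → ι → ℝ) :
    ∫ S, (∫ V, normTerm s (fun U => (∏ c ∈ A'', (pol'' c).fac (smallInd (u c U) (thr S c))) * f''S S U)
        (fun U => (∏ c ∈ A, (pol c).fac (smallInd (u c U) (thr S c))) * fS S U) V ∂fieldMeasure P j G) ∂μ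
      = ∫ S, (∫ V, (∏ c ∈ A, (pol c).fac (smallInd (u c V) (thr S c))) * fS S V ∂fieldMeasure P j G) ∂μ :=
  integral_congr_ae (Filter.Eventually.of_forall fun S => rstepWeight_eq s hsub pol pol'' hpol huI hum fS f''S hP thr S)

end WeightsS

end Summit.QuantumFields.YangMills.Theorems.N21ThresholdMixtureRStepCommonBox

end
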